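import Literature.NumberTheory.EllipticCurves.SupersingularDensitySerreTraceProofs
import Literature.NumberTheory.EllipticCurves.HasseWeilGoodReductionProofs
import Literature.NumberTheory.EllipticCurves.LFunctionPrimeCoeff
import Literature.NumberTheory.EllipticCurves.ComplexMultiplicationDeuringFrobeniusProofs
import HarnessLib

/-!
# Route `PrintCFram`, crux C2 `BottomClassIndexLawFiveLe` (stmt-BirchSwinnertonDyer-20372), line
# `eisenstein-resource-bdp-line` (S2 `stub_kolyvaginUpper_borelCM`, input hCe): a Frobenius that acts
# as a SCALAR on `E[p]` forces `p² ∣ a_q² − 4q` — GENERIC, for any elliptic `E/ℚ`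
# (cell `bsd-print-cfram`, seat `bsd-line-cfram-p1-w4` g3; helper `--supports` 20372; 0 facts, 0 defs)

HONEST FRAMING. Nothing about BSD is proved here, and nothing of S2. This file is the generic half of
the input «hCe» (SCALAR COMMUTANT of `ρ̄_{W,p}(Γ_{K''})` on `W[p]`, the hypothesis
`KolyvaginImage.exists_eq_zsmul` of Gross 1991 Prop. 9.3 / McCallum 1991 (2) in the tree's Kolyvagin
machine `HeegnerPointsKolyvagin*`) for the Borel CM-ramified class: to show that `ρ̄(Γ_{ℚ(√−p)})` is
NOT contained in the scalars one needs ONE Galois element acting non-scalarly on `W[p]`, and this file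
produces it from a Frobenius whose trace square is not `4q` modulo `p²`.

MECHANISM (Silverman, *AEC*, III.§7 and C.21 Remark 21.3; no CM theory, no Lubin–Tate). Let
`σ ∈ Γ_K` act on `E[ℓ] ⊂ E(K̄)` as an integer scalar `c`. In a `ℤ_ℓ`-basis `b` of `T_ℓ E` the images
`P_i = (b_i)_1 ∈ E[ℓ]` form an `𝔽_ℓ`-basis of `E[ℓ]` on which `σ` acts through the reduction of its
matrix `M` (the computation of the tree's `trace_galoisRepTorsion_eq_toZMod_trace_galoisRepTate`), so
`M ≡ c·1 (mod ℓ)` entrywise, and the identity `(tr M)² − 4 det M = (M₀₀ − M₁₁)² + 4·M₀₁M₁₀` gives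
**`ℓ² ∣ (tr σ)² − 4 det σ` on `T_ℓ E`**. For `K = ℚ`, `ℓ = p` and `σ` an arithmetic Frobenius at a
prime `𝔓 ∣ q` of good reduction, `q ≠ p`, the tree's theorems
`trace_galoisRepTate_frobenius_eq_frobeniusTrace` (`tr = a_q`) and
`det_galoisRepTate_frobenius_of_hasGoodReductionAt_holds` (`det = q`) turn this into
**`p² ∣ a_q² − 4q` in `ℤ`**; contrapositively, `p² ∤ a_q² − 4q` makes `σ` NON-SCALAR on `E[p]`.

* §1 `sq_trace_sub_four_mul_det_eq`, `sq_dvd_sq_trace_sub_four_mul_det` — the `2 × 2` identity and its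
  divisibility consequence (any commutative ring).
* §2 `toZMod_toMatrix_galoisRepTate_eq_of_smul_eq` — over any field `K` with `ℓ ≠ char K`: if `σ`
  acts on `E[ℓ]` as the integer `c`, the matrix of `σ` on `T_ℓ E` is `≡ c·1 (mod ℓ)` entrywise;
  `sq_dvd_trace_sq_sub_four_mul_det_of_smul_eq` — hence `ℓ² ∣ tr² − 4 det` in `ℤ_ℓ`.
* §3 `sq_dvd_frobeniusTrace_sq_sub_of_smul_eq` — over `ℚ`: `p² ∣ a_q² − 4q`;
  **`exists_smul_ne_of_not_sq_dvd`** — `p² ∤ a_q² − 4q` ⟹ `∀ c : ℤ, ∃ Q ∈ E[p], σ•Q ≠ c•Q`.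
* §4 `exists_smul_ne_of_addEquiv` / `…_symm` — non-scalarity moves along an additive isomorphism
  `W(ℚ̄) ≃ E(ℚ̄)` commuting with `σ` up to sign (the tree's `DeuringLadic.exists_iso_of_j_eq`:
  curves with the same `j ≠ 0, 1728`), in both directions.

THEOREMS ONLY; no definition, no named fact, no `sorry`; imports no `Theses` module. BSD is not
proved by any of this; no summit statement is proved by this seat.
References: [SilvermanAEC2009] III.§7 (T_ℓ E, E[ℓ] = T_ℓ/ℓT_ℓ), C.21 Remark 21.3 (tr = a_v, det = q_v);
[Serre1981] §8.1 (238); [GrossLMS1991] §9 proof of Prop. 9.3 (the scalar-commutant input).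
-/

set_option autoImplicit false
-- `…BirchSwinnertonDyer.BirchSwinnertonDyer.Theorems…` is the problem's mandated namespace (D-0017).
set_option linter.dupNamespace false

noncomputable section

open scoped Classical NumberField

universe u

namespace Summit.BirchSwinnertonDyer.BirchSwinnertonDyer.Theorems.PrintCFram.BorelNonScalar

open WeierstrassCurve Field IsDedekindDomain Literature.NumberTheory.EllipticCurves
  Literature.NumberTheory.GaloisRepresentations

/-! ## §1 The `2 × 2` identity `(tr M)² − 4 det M = (M₀₀ − M₁₁)² + 4 M₀₁ M₁₀` -/

section Matrix

variable {R : Type*} [CommRing R]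

/-- `(tr M)² − 4 det M = (M₀₀ − M₁₁)² + 4·M₀₁M₁₀` for a `2 × 2` matrix (the discriminant of the
characteristic polynomial). [folklore] -/
theorem sq_trace_sub_four_mul_det_eq (M : Matrix (Fin 2) (Fin 2) R) :
    M.trace ^ 2 - 4 * M.det = (M 0 0 - M 1 1) ^ 2 + 4 * (M 0 1 * M 1 0) := by
  rw [Matrix.trace_fin_two, Matrix.det_fin_two]
  ring

/-- If `M ≡ c·1 (mod ℓ)` entrywise (`ℓ ∣ M₀₀ − M₁₁`, `ℓ ∣ M₀₁`, `ℓ ∣ M₁₀`), then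
`ℓ² ∣ (tr M)² − 4 det M`. [folklore] -/
theorem sq_dvd_sq_trace_sub_four_mul_det {ℓ : R} (M : Matrix (Fin 2) (Fin 2) R)
    (h₀ : ℓ ∣ M 0 0 - M 1 1) (h₁ : ℓ ∣ M 0 1) (h₂ : ℓ ∣ M 1 0) :
    ℓ ^ 2 ∣ M.trace ^ 2 - 4 * M.det := by
  rw [sq_trace_sub_four_mul_det_eq]
  obtain ⟨a, ha⟩ := h₀
  obtain ⟨b, hb⟩ := h₁
  obtain ⟨c, hc⟩ := h₂
  exact ⟨a ^ 2 + 4 * (b * c), by rw [ha, hb, hc]; ring⟩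

end Matrix

/-! ## §2 Any field: a scalar on `E[ℓ]` has matrix `≡ c·1 (mod ℓ)` on `T_ℓ E` -/

section AnyField

variable {K : Type u} [Field K] (W : WeierstrassCurve K) (ℓ : ℕ) [hℓp : Fact ℓ.Prime]

/-- `x ≡ 0 (mod ℓ)` in `ℤ_ℓ` from `x mod ℓ = 0`: the kernel of `PadicInt.toZMod` is `(ℓ)`. [folklore] -/
theorem dvd_of_toZMod_eq_zero {x : ℤ_[ℓ]} (h : PadicInt.toZMod x = 0) : (ℓ : ℤ_[ℓ]) ∣ x := by
  have hx : x ∈ RingHom.ker (PadicInt.toZMod : ℤ_[ℓ] →+* ZMod ℓ) := by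
    rw [RingHom.mem_ker, h]
  rw [PadicInt.ker_toZMod, PadicInt.maximalIdeal_eq_span_p, Ideal.mem_span_singleton] at hx
  exact hx

/-- **A scalar on `E[ℓ]` has matrix `≡ c·1 (mod ℓ)` on `T_ℓ E`.** Let `E/K` be elliptic,
`ℓ ≠ char K`, `σ ∈ Γ_K` acting on `E[ℓ]` as the integer `c`, and `b` a `ℤ_ℓ`-basis of `T_ℓ E`. Then
the matrix `M` of `σ` on `T_ℓ E` satisfies `M_{ij} mod ℓ = c δ_{ij}`: the images `P_i ∈ E[ℓ]` of the
`b_i` form an `𝔽_ℓ`-basis of `E[ℓ]` (`T_ℓ E → E[ℓ]` onto, `#E[ℓ] = ℓ²`), and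
`σ P_j = Σ_i (M_{ij} mod ℓ) P_i` (Silverman, *AEC*, III.§7; the computation of the tree's
`trace_galoisRepTorsion_eq_toZMod_trace_galoisRepTate`). [cite: SilvermanAEC2009, III.§7 (T_ℓ E and E[ℓ^n])] -/
theorem toZMod_toMatrix_galoisRepTate_eq_of_smul_eq [W.IsElliptic] (hℓ : (ℓ : K) ≠ 0)
    (σ : absoluteGaloisGroup K) {c : ℤ} (hc : ∀ Q : geomTorsion W ℓ, σ • Q = c • Q)
    (b : Module.Basis (Fin 2) ℤ_[ℓ] (W.tateModule ℓ)) (i j : Fin 2) :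
    PadicInt.toZMod (LinearMap.toMatrix b b (W.galoisRepTate ℓ σ) i j) =
      if i = j then (c : ZMod ℓ) else 0 := by
  letI : Module (ZMod ℓ) (geomTorsion W ℓ) := AddSubgroup.torsionBy.zmodModule
  have hp : ℓ.Prime := Fact.out
  -- the images `P i ∈ E[ℓ]` of the basis vectors
  have hmem : ∀ i, TateModule.proj ℓ 1 (b i) ∈ geomTorsion W ℓ := fun i ↦ by
    simpa only [pow_one] using proj_tateModule_mem_geomTorsion W ℓ 1 (b i)
  let P : Fin 2 → geomTorsion W ℓ := fun i ↦ ⟨TateModule.proj ℓ 1 (b i), hmem i⟩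
  -- the `𝔽_ℓ`-linear map `(x₀, x₁) ↦ x₀ P₀ + x₁ P₁`
  let L : (Fin 2 → ZMod ℓ) →ₗ[ZMod ℓ] geomTorsion W ℓ := Fintype.linearCombination (ZMod ℓ) P
  have hL : ∀ x : Fin 2 → ZMod ℓ, L x = x 0 • P 0 + x 1 • P 1 := fun x ↦ by
    simp only [L, Fintype.linearCombination_apply, Fin.sum_univ_two]
  have hLcoe : ∀ x y : ℤ_[ℓ], ((L ![PadicInt.toZMod x, PadicInt.toZMod y] : geomTorsion W ℓ) :
      geomPoints W) = (PadicInt.toZModPow 1 x).val • TateModule.proj ℓ 1 (b 0) +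
        (PadicInt.toZModPow 1 y).val • TateModule.proj ℓ 1 (b 1) := fun x y ↦ by
    rw [hL]
    simp only [Matrix.cons_val_zero, Matrix.cons_val_one, Matrix.cons_val_fin_one]
    rw [toZMod_smul_geomTorsion_eq, toZMod_smul_geomTorsion_eq, AddSubgroup.coe_add,
      AddSubgroupClass.coe_nsmul, AddSubgroupClass.coe_nsmul]
  -- `L` is onto: `T_ℓ E → E[ℓ]` is onto
  have hLsurj : Function.Surjective L := fun S ↦ by
    have hS : (S : geomPoints W) ∈ geomTorsion W (ℓ ^ 1 : ℕ) := by
      simpa only [pow_one] using S.2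
    obtain ⟨a, ha⟩ := proj_surjective_of_isAlgClosed_holds W ℓ 1 hS
    refine ⟨![PadicInt.toZMod (b.repr a 0), PadicInt.toZMod (b.repr a 1)], Subtype.ext ?_⟩
    rw [hLcoe, ← proj_eq_sum_repr W ℓ b a 1, ha]
  -- hence bijective, `#E[ℓ] = ℓ² = #𝔽_ℓ²`
  have hℓ' : (ℓ : AlgebraicClosure K) ≠ 0 := fun h ↦ hℓ <|
    (algebraMap K (AlgebraicClosure K)).injective (by rw [map_natCast, map_zero, h])
  haveI : Finite (geomTorsion W ℓ) :=
    finite_torsionPoints_holds W (AlgebraicClosure K) (n := ℓ) (by exact_mod_cast hp.ne_zero)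
  have hcardE : Nat.card (geomTorsion W ℓ) = ℓ ^ 2 :=
    card_torsionPoints_eq_sq_holds W (AlgebraicClosure K) (n := ℓ) hℓ'
  have hLbij : Function.Bijective L := by
    rw [Nat.bijective_iff_surjective_and_card]
    refine ⟨hLsurj, ?_⟩
    rw [hcardE, Nat.card_fun, Nat.card_eq_fintype_card, ZMod.card, Nat.card_eq_fintype_card,
      Fintype.card_fin]
  -- the matrix of `σ` on `T_ℓ E` and the action on the `P j`
  set M := LinearMap.toMatrix b b (W.galoisRepTate ℓ σ) with hMdef
  have hcol : ∀ j, σ • P j = L ![PadicInt.toZMod (M 0 j), PadicInt.toZMod (M 1 j)] := fun j ↦ by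
    refine Subtype.ext ?_
    rw [AddSubgroup.torsionBy.coe_smul, hLcoe]
    show σ • TateModule.proj ℓ 1 (b j) = _
    have h1 : σ • TateModule.proj ℓ 1 (b j) = TateModule.proj ℓ 1 (W.galoisRepTate ℓ σ (b j)) := by
      rw [galoisRepTate_apply_apply, TateModule.proj_smul_of_distribMulAction]
    rw [h1, proj_eq_sum_repr W ℓ b _ 1, hMdef, LinearMap.toMatrix_apply, LinearMap.toMatrix_apply]
  -- `σ • P j = c • P j = L (c e_j)`
  have hcol' : ∀ j, σ • P j = L (Pi.single j (c : ZMod ℓ)) := fun j ↦ by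
    rw [hc (P j), Fintype.linearCombination_apply_single, Int.cast_smul_eq_zsmul]
  have hvec : ![PadicInt.toZMod (M 0 j), PadicInt.toZMod (M 1 j)] = Pi.single j (c : ZMod ℓ) :=
    hLbij.1 ((hcol j).symm.trans (hcol' j))
  have hij := congrFun hvec i
  rw [Pi.single_apply] at hij
  fin_cases i
  · simpa using hij
  · simpa using hij

/-- **`ℓ² ∣ (tr σ)² − 4 det σ` on `T_ℓ E` when `σ` is a scalar on `E[ℓ]`** (any field `K`,
`ℓ ≠ char K`): the matrix of `σ` in a `ℤ_ℓ`-basis is `≡ c·1 (mod ℓ)`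
(`toZMod_toMatrix_galoisRepTate_eq_of_smul_eq`) and §1 applies. [cite: SilvermanAEC2009, III.§7 (T_ℓ E and E[ℓ^n])] -/
theorem sq_dvd_trace_sq_sub_four_mul_det_of_smul_eq [W.IsElliptic] (hℓ : (ℓ : K) ≠ 0)
    (σ : absoluteGaloisGroup K) {c : ℤ} (hc : ∀ Q : geomTorsion W ℓ, σ • Q = c • Q) :
    (ℓ : ℤ_[ℓ]) ^ 2 ∣
      (LinearMap.trace ℤ_[ℓ] (W.tateModule ℓ) (W.galoisRepTate ℓ σ)) ^ 2 -
        4 * LinearMap.det (W.galoisRepTate ℓ σ : W.tateModule ℓ →ₗ[ℤ_[ℓ]] W.tateModule ℓ) := by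
  haveI := module_free_tateModule_holds W ℓ
  haveI := module_finite_tateModule_holds W ℓ
  let b := Module.finBasisOfFinrankEq ℤ_[ℓ] (W.tateModule ℓ) (finrank_tateModule_eq_two_holds W ℓ hℓ)
  have hent := toZMod_toMatrix_galoisRepTate_eq_of_smul_eq W ℓ hℓ σ hc b
  rw [LinearMap.trace_eq_matrix_trace ℤ_[ℓ] b, ← LinearMap.det_toMatrix b]
  refine sq_dvd_sq_trace_sub_four_mul_det _ ?_ ?_ ?_
  · refine dvd_of_toZMod_eq_zero ℓ ?_
    rw [map_sub, hent, hent]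
    simp
  · refine dvd_of_toZMod_eq_zero ℓ ?_
    rw [hent]
    simp
  · refine dvd_of_toZMod_eq_zero ℓ ?_
    rw [hent]
    simp

end AnyField

/-! ## §3 Over `ℚ`: an arithmetic Frobenius scalar on `E[p]` forces `p² ∣ a_q² − 4q` -/

section Rat

open NumberField Rat.HeightOneSpectrum

variable (W : WeierstrassCurve ℚ) [W.IsElliptic] [W.IsGloballyMinimal] (p : ℕ) [hp : Fact p.Prime]

/-- `pⁿ ∣ k` in `ℤ` from `pⁿ ∣ k` in `ℤ_p` (`‖k‖_p ≤ p^{-n}`). [folklore] -/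
theorem int_pow_dvd_of_padicInt_pow_dvd {k : ℤ} {n : ℕ} (h : (p : ℤ_[p]) ^ n ∣ (k : ℤ_[p])) :
    (p : ℤ) ^ n ∣ k := by
  have h1 : (k : ℤ_[p]) ∈ Ideal.span {(p : ℤ_[p]) ^ n} := Ideal.mem_span_singleton.mpr h
  rw [← PadicInt.norm_le_pow_iff_mem_span_pow] at h1
  have h2 := PadicInt.norm_int_le_pow_iff_dvd.mp h1
  exact_mod_cast h2

/-- **A Frobenius that is a scalar on `E[p]` forces `p² ∣ a_q² − 4q`.** Let `E = W/ℚ` be elliptic and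
globally minimal, `p` a prime, `q ≠ p` a prime of good reduction, `v` the place at `q`, `𝔓 ∣ v` a prime
of `\bar ℤ`, `σ` an arithmetic Frobenius at `𝔓`. If `σ` acts on `E[p]` as an integer `c`, then
`p² ∣ a_q² − 4q`: §2 with `tr(σ | T_p E) = a_q` (the tree's `trace_galoisRepTate_frobenius_eq_frobeniusTrace`)
and `det(σ | T_p E) = q` (`det_galoisRepTate_frobenius_of_hasGoodReductionAt_holds`).
[cite: SilvermanAEC2009, C.21 Remark 21.3 (tr ρ(φ_v) = a_v, det = q_v)] [cite: SilvermanAEC2009, III.§7 (T_ℓ E and E[ℓ^n])] -/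
theorem sq_dvd_frobeniusTrace_sq_sub_of_smul_eq {q : ℕ} [hq : Fact q.Prime] (hqp : q ≠ p)
    (hgood : W.HasGoodReductionAtPrime q) {v : HeightOneSpectrum (𝓞 ℚ)} (hv : (primesEquiv v : ℕ) = q)
    {𝔓 : Ideal (absIntegers (𝓞 ℚ) ℚ)} (h𝔓 : 𝔓 ∈ v.primesAbove)
    {σ : absoluteGaloisGroup ℚ} (hσ : IsArithFrobAt (𝓞 ℚ) σ 𝔓)
    {c : ℤ} (hc : ∀ Q : geomTorsion W p, σ • Q = c • Q) :
    ((p : ℤ) ^ 2) ∣ W.frobeniusTrace q ^ 2 - 4 * q := by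
  have hpr : p.Prime := hp.out
  have hpQ : (p : ℚ) ≠ 0 := Nat.cast_ne_zero.mpr hpr.ne_zero
  have hne : (primesEquiv v : ℕ) ≠ p := hv ▸ hqp
  have hgood' : W.HasGoodReductionAt v := (hasGoodReductionAtPrime_primesEquiv_iff_holds W v q hv).mp hgood
  have hpv : (p : 𝓞 ℚ) ∉ v.asIdeal := natCast_not_mem_asIdeal_of_primesEquiv_ne hpr hne
  have h := sq_dvd_trace_sq_sub_four_mul_det_of_smul_eq W p hpQ σ hc
  rw [W.trace_galoisRepTate_frobenius_eq_frobeniusTrace p hne hgood' h𝔓 hσ,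
    W.det_galoisRepTate_frobenius_of_hasGoodReductionAt_holds p v hpv hgood' h𝔓 hσ,
    natCard_residueField_adicCompletionIntegers v, hv] at h
  refine int_pow_dvd_of_padicInt_pow_dvd p ?_
  push_cast
  exact h

/-- **Non-scalarity of Frobenius on `E[p]` from `p² ∤ a_q² − 4q`** (contrapositive of
`sq_dvd_frobeniusTrace_sq_sub_of_smul_eq`): for every integer `c` some `Q ∈ E[p]` has `σ•Q ≠ c•Q`.
[cite: SilvermanAEC2009, C.21 Remark 21.3 (tr ρ(φ_v) = a_v, det = q_v)] -/
theorem exists_smul_ne_of_not_sq_dvd {q : ℕ} [hq : Fact q.Prime] (hqp : q ≠ p)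
    (hgood : W.HasGoodReductionAtPrime q) {v : HeightOneSpectrum (𝓞 ℚ)} (hv : (primesEquiv v : ℕ) = q)
    {𝔓 : Ideal (absIntegers (𝓞 ℚ) ℚ)} (h𝔓 : 𝔓 ∈ v.primesAbove)
    {σ : absoluteGaloisGroup ℚ} (hσ : IsArithFrobAt (𝓞 ℚ) σ 𝔓)
    (hnd : ¬ ((p : ℤ) ^ 2) ∣ W.frobeniusTrace q ^ 2 - 4 * q) (c : ℤ) :
    ∃ Q : geomTorsion W p, σ • Q ≠ c • Q := by
  by_contra hall
  push Not at hall
  exact hnd (sq_dvd_frobeniusTrace_sq_sub_of_smul_eq W p hqp hgood hv h𝔓 hσ hall)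

end Rat

/-! ## §4 Transport of non-scalarity along a `ℚ̄`-isomorphism commuting with `σ` up to sign -/

section Transport

variable {W E : WeierstrassCurve ℚ} (n : ℤ)

/-- An additive isomorphism `ι : W(ℚ̄) ≃ E(ℚ̄)` maps `W[n]` into `E[n]`. [folklore] -/
theorem addEquiv_mem_geomTorsion (ι : W.geomPoints ≃+ E.geomPoints) (P : geomTorsion W n) :
    ι (P : W.geomPoints) ∈ geomTorsion E n := by
  rw [mem_geomTorsion_iff, ← map_zsmul, (mem_geomTorsion_iff W n _).mp P.2, map_zero]

/-- **Non-scalarity moves along `ι : W(ℚ̄) ≃ E(ℚ̄)` commuting with `σ` up to sign** (from `E` to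
`W`): if `σ` were the scalar `c` on `W[n]`, it would be the scalar `±c` on `E[n]`. (For curves with
the same `j ≠ 0, 1728` such `ι` is the tree's `DeuringLadic.exists_iso_of_j_eq`, Silverman X.5.4.)
[cite: SilvermanAEC2009, X.5 Prop. 5.4 and Cor. 5.4.1] -/
theorem exists_smul_ne_of_addEquiv (ι : W.geomPoints ≃+ E.geomPoints) {σ : absoluteGaloisGroup ℚ}
    (hι : (∀ P, ι (σ • P) = σ • ι P) ∨ (∀ P, ι (σ • P) = -(σ • ι P)))
    (hE : ∀ c : ℤ, ∃ Q : geomTorsion E n, σ • Q ≠ c • Q) (c : ℤ) :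
    ∃ Q : geomTorsion W n, σ • Q ≠ c • Q := by
  by_contra hall
  push Not at hall
  have hall' : ∀ P : geomTorsion W n, σ • (P : W.geomPoints) = c • (P : W.geomPoints) := fun P ↦ by
    have := congrArg Subtype.val (hall P)
    rwa [AddSubgroup.torsionBy.coe_smul, AddSubgroupClass.coe_zsmul] at this
  -- every `Q ∈ E[n]` is `ι P` with `P = ι⁻¹ Q ∈ W[n]`
  have hpre : ∀ Q : geomTorsion E n, ∃ P : geomTorsion W n, ι (P : W.geomPoints) = Q := fun Q ↦
    ⟨⟨ι.symm Q, addEquiv_mem_geomTorsion n ι.symm Q⟩, ι.apply_symm_apply _⟩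
  rcases hι with h | h
  · obtain ⟨Q, hQ⟩ := hE c
    obtain ⟨P, hP⟩ := hpre Q
    apply hQ
    apply Subtype.ext
    rw [AddSubgroup.torsionBy.coe_smul, AddSubgroupClass.coe_zsmul, ← hP, ← h, hall', map_zsmul]
  · obtain ⟨Q, hQ⟩ := hE (-c)
    obtain ⟨P, hP⟩ := hpre Q
    apply hQ
    apply Subtype.ext
    have h' : σ • ι (P : W.geomPoints) = -ι (σ • (P : W.geomPoints)) :=
      (neg_eq_iff_eq_neg.mpr (h P)).symm
    rw [AddSubgroup.torsionBy.coe_smul, AddSubgroupClass.coe_zsmul, ← hP, h', hall', map_zsmul,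
      neg_smul]

/-- The same transport in the other direction (from `W` to `E`), through `ι⁻¹`
(`DeuringLadic.symm_smul_of`, `symm_smul_neg_of`). [cite: SilvermanAEC2009, X.5 Prop. 5.4 and Cor. 5.4.1] -/
theorem exists_smul_ne_of_addEquiv_symm (ι : W.geomPoints ≃+ E.geomPoints)
    {σ : absoluteGaloisGroup ℚ}
    (hι : (∀ P, ι (σ • P) = σ • ι P) ∨ (∀ P, ι (σ • P) = -(σ • ι P)))
    (hW : ∀ c : ℤ, ∃ Q : geomTorsion W n, σ • Q ≠ c • Q) (c : ℤ) :
    ∃ Q : geomTorsion E n, σ • Q ≠ c • Q := by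
  refine exists_smul_ne_of_addEquiv n ι.symm ?_ hW c
  rcases hι with h | h
  · exact Or.inl (DeuringLadic.symm_smul_of ι h)
  · exact Or.inr (DeuringLadic.symm_smul_neg_of ι h)

end Transport

end Summit.BirchSwinnertonDyer.BirchSwinnertonDyer.Theorems.PrintCFram.BorelNonScalar
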